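import Summits.NavierStokesRegularity.NavierStokesRegularity.Theorems.StrainDoorsLinearPressurePairing
import Summits.NavierStokesRegularity.NavierStokesRegularity.Theorems.StrainDoorsWindowCutoff
import HarnessLib

/-!
# Strain doors, PART M §M31(c) — the a.e. slice bound of the local energy right-hand side under the rate

ROUND 70 of the `ns-regularity-ideate` programme (p1 line; helper lane of `stmt-NavierStokesRegularity-0056`,
rung N0; nothing here is a claim about Navier–Stokes regularity).  ROUND 69 proved door X′ (the `L²`-Morrey Type-I
bound from the sup-norm rate IN THE ENERGY CLASS, constant `M₂(M, ‖u₀‖₂, T₀)`) and typed door X″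
`UlocMorreyBoundSupTypeI`: the same bound with an `M`-ONLY constant at all radii `r² < T`.  ROUND 70 CLOSES X″ by a
uniformly-local energy Grönwall argument under the rate, in three links, ALL PROVED: LINK 1 (the pressure pairing of
the local energy inequality is LINEAR in the local energies under a sup bound, `M`-free constants — texts N11a/N11b),
LINK 2 (the sliced local energy inequality under the rate at unit scale is linear with `M`-only data — typed in N11c,
PROVED in N11e/N11f/N11g), LINK 3 (LINK 2 ⇒ X″ by Grönwall and Leray rescaling — N11c); N11d puts them together:
`ulocMorreyBoundSupTypeI_holds : UlocMorreyBoundSupTypeI`.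

THIS FILE (imports N11b for §M29(c) `exists_pressurePairing_le_linear` and N11e): for a slice `σ ∈ (T−1, T)` of a
classical divergence-free field `u(σ)` with `|u(σ)| ≤ K_b` (`K_b = M/√(T−σ)`) and the window cut-off `ζ = ζ_{T,y}`:
* `sliceKinetic_le` — `∫ |u|²(∂ₛζ + Δζ) + |u|² u·∇ζ ≤ (2 + K_b) M_ζ · 64 · ulocEnergy (u σ)` (averaging at `R = 3`);
* `slicePressure_eq` — for a pressure `p(σ) = p̃[u(σ)] + c` (the Seregin–Šverák gauge) the constant dies:
  `∫ 2 p u·∇ζ = 2 ∫ p̃[u] u·∇ζ`, because `∫ u·∇ζ = 0`;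
* `sliceRHS_le` — with §M29(c) at `r = 3` (`343 = (6+1)³`): `ofReal (∫ R[ζ](σ,·)) ≤ (W₁ + W₂ · ofReal K_b) · ulocEnergy (u σ)`
  with the ABSOLUTE weights `linkWeight₁ M_ζ = 64 · ofReal (2M_ζ)`, `linkWeight₂ M_ζ C₁ C₂ = ofReal M_ζ · (64 + 2(343 C₁ + C₂))`.
Two definitions (`linkWeight₁`, `linkWeight₂`, noncomputable constants) ⇒ S-lane `--kind definition`.
No `sorry`, no new axioms, no instances, no notation.
-/

noncomputable section

set_option linter.dupNamespace false

open MeasureTheory Set Function Filter Metric Real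
open _root_.Topology
open scoped ENNReal NNReal RealInnerProductSpace Laplacian
open Literature.Analysis Literature.Analysis.FluidPDE

namespace Summit.NavierStokesRegularity.NavierStokesRegularity.Theorems.StrainDoors

/-! ### §M31(c) The a.e. slice bound of the local energy right-hand side under the rate -/

/-- Joint continuity of the local-energy weights `ζ, ∂ₛζ, Δζ, ∇ζ` of a test function on `ℝ × ℝ³`.
[folklore] -/
theorem continuous_weights_of_isSpaceTimeTestOn {ζ : ℝ → EuclideanSpace ℝ (Fin 3) → ℝ}
    (hζ : IsSpaceTimeTestOn (⊤ : TopologicalSpace.Opens (ℝ × EuclideanSpace ℝ (Fin 3))) ζ) :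
    (Continuous fun z : ℝ × EuclideanSpace ℝ (Fin 3) => ζ z.1 z.2) ∧
    (Continuous fun z : ℝ × EuclideanSpace ℝ (Fin 3) => timeDeriv ζ z.1 z.2) ∧
    (Continuous fun z : ℝ × EuclideanSpace ℝ (Fin 3) => (Δ (ζ z.1)) z.2) ∧
    Continuous fun z : ℝ × EuclideanSpace ℝ (Fin 3) => gradient (ζ z.1) z.2 := by
  refine ⟨hζ.contDiff.continuous, hζ.continuous_timeDeriv, ?_, ?_⟩
  · have h := ((hζ.isSmoothSpaceTimeOn univ).laplacian uniqueDiffOn_univ).continuousOn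
    rw [univ_prod_univ, continuousOn_univ] at h
    exact h
  · have h := ((hζ.isSmoothSpaceTimeOn univ).gradient uniqueDiffOn_univ).continuousOn
    rw [univ_prod_univ, continuousOn_univ] at h
    exact h

/-- The two Grönwall weights of LINK 2 produced by the proof: `B₁ = 64 · 2M_Z` (cut-off derivatives)
and `B₂ = M_Z (64 + 2 (343 C₁ + C₂))` (cubic term + linear pressure pairing of §M29(c) at `r = 3`).
[folklore] -/
noncomputable def linkWeight₁ (Mz : ℝ) : ℝ≥0∞ := (64 : ℝ≥0∞) * ENNReal.ofReal (2 * Mz)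

/-- See `linkWeight₁`. [folklore] -/
noncomputable def linkWeight₂ (Mz : ℝ) (C₁ C₂ : ℝ≥0∞) : ℝ≥0∞ :=
  ENNReal.ofReal Mz * ((64 : ℝ≥0∞) + (2 : ℝ≥0∞) * ((343 : ℝ≥0∞) * C₁ + C₂))

/-- Continuity in `x` of the weight slices `∂ₛζ(σ,·), Δζ(σ,·), ∇ζ(σ,·)` of the window cut-off.
[folklore] -/
theorem continuous_winCutoffAt_weights (T : ℝ) (y : EuclideanSpace ℝ (Fin 3)) (σ : ℝ) :
    (Continuous fun x => timeDeriv (winCutoffAt T y) σ x) ∧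
    (Continuous fun x => (Δ (winCutoffAt T y σ)) x) ∧
    Continuous fun x => gradient (winCutoffAt T y σ) x := by
  obtain ⟨-, hca, hcl, hcg⟩ := continuous_weights_of_isSpaceTimeTestOn (isSpaceTimeTestOn_winCutoffAt T y)
  have hsl : Continuous fun x : EuclideanSpace ℝ (Fin 3) => ((σ, x) : ℝ × EuclideanSpace ℝ (Fin 3)) :=
    continuous_const.prodMk continuous_id
  have h1 := hca.comp hsl
  have h2 := hcl.comp hsl
  have h3 := hcg.comp hsl
  simp only [Function.comp_def] at h1 h2 h3
  exact ⟨h1, h2, h3⟩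

/-- A function on `ℝ³` vanishing off `B(y, 3)` has compact support. [folklore] -/
theorem hasCompactSupport_of_eq_zero_off_ball {β : Type*} [Zero β] {y : EuclideanSpace ℝ (Fin 3)}
    {F : EuclideanSpace ℝ (Fin 3) → β} (hF : ∀ x, x ∉ ball y 3 → F x = 0) : HasCompactSupport F :=
  HasCompactSupport.intro (isCompact_closedBall y 3) fun x hx => hF x fun hx' => hx (ball_subset_closedBall hx')

/-- Off `B(y, 3)` the weight slices of the window cut-off vanish. [folklore] -/
theorem winCutoffAt_weights_eq_zero_off_ball {T : ℝ} {y : EuclideanSpace ℝ (Fin 3)} {σ : ℝ}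
    {x : EuclideanSpace ℝ (Fin 3)} (hx : x ∉ ball y 3) :
    timeDeriv (winCutoffAt T y) σ x = 0 ∧ (Δ (winCutoffAt T y σ)) x = 0 ∧
      gradient (winCutoffAt T y σ) x = 0 := by
  have h := winCutoffAt_weights_eq_zero (T := T) (y := y) (s := σ) (x := x)
    (Or.inr (by rw [mem_ball, dist_eq_norm] at hx; linarith))
  exact ⟨h.2.2.2, h.2.2.1, h.2.1⟩

/-- **Kinetic part of the slice bound**: `∫ (|u|²(∂ζ + Δζ) + |u|² u·∇ζ)(σ,·) ≤ (2 + K_b) M_Z · 64 ·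
ulocEnergy(u(σ))` for a continuous slice bounded by `K_b`. [folklore] -/
theorem sliceKinetic_le {Mz : ℝ}
    (hM : (∀ s x, |timeDeriv winCutoff s x| ≤ Mz) ∧ (∀ s x, |(Δ (winCutoff s)) x| ≤ Mz) ∧
      (∀ s x, ‖gradient (winCutoff s) x‖ ≤ Mz))
    {T : ℝ} {y : EuclideanSpace ℝ (Fin 3)}
    {u : ℝ → EuclideanSpace ℝ (Fin 3) → EuclideanSpace ℝ (Fin 3)} {σ Kb : ℝ} (hKb : 0 ≤ Kb)
    (hwc : Continuous (u σ)) (hub : ∀ x, ‖u σ x‖ ≤ Kb) :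
    Integrable (fun x => ‖u σ x‖ ^ 2 * (timeDeriv (winCutoffAt T y) σ x + (Δ (winCutoffAt T y σ)) x) +
      ‖u σ x‖ ^ 2 * ⟪u σ x, gradient (winCutoffAt T y σ) x⟫) volume ∧
    ENNReal.ofReal (∫ x, ‖u σ x‖ ^ 2 * (timeDeriv (winCutoffAt T y) σ x + (Δ (winCutoffAt T y σ)) x) +
      ‖u σ x‖ ^ 2 * ⟪u σ x, gradient (winCutoffAt T y σ) x⟫) ≤
      ENNReal.ofReal ((2 + Kb) * Mz) * (64 * ulocEnergy (u σ)) := by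
  -- Landing edit (hand ns-s29-p2 g7; gate `dedup.landed` on the planner's top-level helper
  -- `ofReal_integral_le_lintegral_ofReal_any` ≡ `Literature.MathematicalPhysics.KineticTheory.ofReal_integral_le_lintegral`,
  -- whose import cone is foreign to this file): the helper is inlined as a local `have`; all statements unchanged.
  have ofReal_integral_le_lintegral_ofReal_any : ∀ g : EuclideanSpace ℝ (Fin 3) → ℝ,
      ENNReal.ofReal (∫ x, g x) ≤ ∫⁻ x, ENNReal.ofReal (g x) := fun g => by
    by_cases hgi : Integrable g volume
    · calc ENNReal.ofReal (∫ x, g x) ≤ ENNReal.ofReal (∫ x, max (g x) 0) :=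
            ENNReal.ofReal_le_ofReal (integral_mono hgi hgi.pos_part fun x => le_max_left _ _)
        _ = ∫⁻ x, ENNReal.ofReal (max (g x) 0) :=
            ofReal_integral_eq_lintegral_ofReal hgi.pos_part (Eventually.of_forall fun x => le_max_right _ _)
        _ = ∫⁻ x, ENNReal.ofReal (g x) := lintegral_congr fun x => by
            rcases le_total (g x) 0 with hx | hx
            · rw [max_eq_right hx, ENNReal.ofReal_zero, ENNReal.ofReal_of_nonpos hx]
            · rw [max_eq_left hx]
    · rw [integral_undef hgi, ENNReal.ofReal_zero]; exact bot_le
  have hMz : 0 ≤ Mz := (abs_nonneg _).trans (hM.1 0 0)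
  obtain ⟨hac, hlc, hgc⟩ := continuous_winCutoffAt_weights T y σ
  have hw_ae : AEStronglyMeasurable (u σ) volume := hwc.aestronglyMeasurable
  have hbd := fun x => winCutoffAt_deriv_bound hM T y σ x
  have hF0 : ∀ x, x ∉ ball y 3 →
      ‖u σ x‖ ^ 2 * (timeDeriv (winCutoffAt T y) σ x + (Δ (winCutoffAt T y σ)) x) +
        ‖u σ x‖ ^ 2 * ⟪u σ x, gradient (winCutoffAt T y σ) x⟫ = 0 := fun x hx => by
    obtain ⟨h1, h2, h3⟩ := winCutoffAt_weights_eq_zero_off_ball (T := T) (y := y) (σ := σ) hx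
    rw [h1, h2, h3, inner_zero_right]; ring
  have hFc : Continuous fun x => ‖u σ x‖ ^ 2 * (timeDeriv (winCutoffAt T y) σ x +
      (Δ (winCutoffAt T y σ)) x) + ‖u σ x‖ ^ 2 * ⟪u σ x, gradient (winCutoffAt T y σ) x⟫ :=
    ((hwc.norm.pow 2).mul (hac.add hlc)).add ((hwc.norm.pow 2).mul (hwc.inner hgc))
  refine ⟨hFc.integrable_of_hasCompactSupport (hasCompactSupport_of_eq_zero_off_ball hF0), ?_⟩
  have hball3 : ∫⁻ x in ball y 3, ‖u σ x‖ₑ ^ 2 ≤ 64 * ulocEnergy (u σ) := by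
    have h := setLIntegral_ball_le_mul_ulocEnergy hw_ae y (by norm_num : (0 : ℝ) < 3)
    rw [show ENNReal.ofReal ((3 + 1) ^ 3 : ℝ) = 64 by norm_num] at h
    exact h
  have hpt : ∀ x, ENNReal.ofReal (‖u σ x‖ ^ 2 * (timeDeriv (winCutoffAt T y) σ x +
      (Δ (winCutoffAt T y σ)) x) + ‖u σ x‖ ^ 2 * ⟪u σ x, gradient (winCutoffAt T y σ) x⟫) ≤
      (ball y 3).indicator (fun x => ENNReal.ofReal ((2 + Kb) * Mz) * ‖u σ x‖ₑ ^ 2) x := by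
    intro x
    by_cases hx : x ∈ ball y 3
    · rw [indicator_of_mem hx]
      have i1 : ‖u σ x‖ ^ 2 * (timeDeriv (winCutoffAt T y) σ x + (Δ (winCutoffAt T y σ)) x) ≤
          ‖u σ x‖ ^ 2 * (2 * Mz) :=
        mul_le_mul_of_nonneg_left (by
          linarith [le_abs_self (timeDeriv (winCutoffAt T y) σ x), le_abs_self ((Δ (winCutoffAt T y σ)) x),
            (hbd x).1, (hbd x).2.1]) (sq_nonneg _)
      have i2 : ‖u σ x‖ ^ 2 * ⟪u σ x, gradient (winCutoffAt T y σ) x⟫ ≤ ‖u σ x‖ ^ 2 * (Kb * Mz) :=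
        mul_le_mul_of_nonneg_left ((real_inner_le_norm _ _).trans
          (mul_le_mul (hub x) (hbd x).2.2 (norm_nonneg _) hKb)) (sq_nonneg _)
      calc ENNReal.ofReal (‖u σ x‖ ^ 2 * (timeDeriv (winCutoffAt T y) σ x + (Δ (winCutoffAt T y σ)) x) +
              ‖u σ x‖ ^ 2 * ⟪u σ x, gradient (winCutoffAt T y σ) x⟫)
          ≤ ENNReal.ofReal ((2 + Kb) * Mz * ‖u σ x‖ ^ 2) :=
            ENNReal.ofReal_le_ofReal ((add_le_add i1 i2).trans (le_of_eq (by ring)))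
        _ = ENNReal.ofReal ((2 + Kb) * Mz) * ‖u σ x‖ₑ ^ 2 := by
            rw [ENNReal.ofReal_mul (by positivity), ← ofReal_norm (u σ x),
              ← ENNReal.ofReal_pow (norm_nonneg _)]
    · rw [indicator_of_notMem hx, hF0 x hx, ENNReal.ofReal_zero]
  have hm : Measurable fun x => ‖u σ x‖ₑ ^ 2 := (hwc.measurable.enorm).pow_const 2
  calc ENNReal.ofReal (∫ x, ‖u σ x‖ ^ 2 * (timeDeriv (winCutoffAt T y) σ x + (Δ (winCutoffAt T y σ)) x) +
          ‖u σ x‖ ^ 2 * ⟪u σ x, gradient (winCutoffAt T y σ) x⟫)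
      ≤ ∫⁻ x, ENNReal.ofReal (‖u σ x‖ ^ 2 * (timeDeriv (winCutoffAt T y) σ x + (Δ (winCutoffAt T y σ)) x) +
          ‖u σ x‖ ^ 2 * ⟪u σ x, gradient (winCutoffAt T y σ) x⟫) :=
        ofReal_integral_le_lintegral_ofReal_any _
    _ ≤ ∫⁻ x, (ball y 3).indicator (fun x => ENNReal.ofReal ((2 + Kb) * Mz) * ‖u σ x‖ₑ ^ 2) x :=
        lintegral_mono hpt
    _ = ENNReal.ofReal ((2 + Kb) * Mz) * ∫⁻ x in ball y 3, ‖u σ x‖ₑ ^ 2 := by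
        rw [lintegral_indicator measurableSet_ball, lintegral_const_mul _ hm]
    _ ≤ ENNReal.ofReal ((2 + Kb) * Mz) * (64 * ulocEnergy (u σ)) := mul_le_mul' le_rfl hball3

/-- **Pressure part of the slice bound**: with the gauge `p(σ) = p̃[u(σ)] + c` and the
orthogonality `∫ ⟪u, ∇ζ⟫ = 0`, `∫ 2 p ⟪u, ∇ζ⟫ = 2 ∫ p̃ ⟪u, ∇ζ⟫`. [cite: Leray1934, §6 (1.11) p. 203] -/
theorem slicePressure_eq {T : ℝ} {y : EuclideanSpace ℝ (Fin 3)}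
    {u : ℝ → EuclideanSpace ℝ (Fin 3) → EuclideanSpace ℝ (Fin 3)} {p : ℝ → EuclideanSpace ℝ (Fin 3) → ℝ}
    {σ c : ℝ} (hu1 : ContDiff ℝ 1 (u σ)) (hdiv : VectorCalculus.IsDivFree (u σ))
    (hpc : Continuous (p σ)) (hgauge : ∀ x, p σ x = normalisedPressure (u σ) x + c) :
    Integrable (fun x => 2 * p σ x * ⟪u σ x, gradient (winCutoffAt T y σ) x⟫) volume ∧
    ∫ x, ⟪u σ x, gradient (winCutoffAt T y σ) x⟫ = 0 ∧
    ∫ x, 2 * p σ x * ⟪u σ x, gradient (winCutoffAt T y σ) x⟫ =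
      2 * ∫ x, normalisedPressure (u σ) x * ⟪u σ x, gradient (winCutoffAt T y σ) x⟫ := by
  have hζ := isSpaceTimeTestOn_winCutoffAt T y
  obtain ⟨-, -, hgc⟩ := continuous_winCutoffAt_weights T y σ
  have hwc : Continuous (u σ) := hu1.continuous
  have horth : ∫ x, ⟪u σ x, gradient (winCutoffAt T y σ) x⟫ = 0 :=
    integral_inner_gradient_eq_zero_of_isDivFree hu1 hdiv
      ((hζ.contDiff_slice σ).of_le (by exact_mod_cast le_top)) (hζ.hasCompactSupport_slice σ)
  have hwg_c : Continuous fun x => ⟪u σ x, gradient (winCutoffAt T y σ) x⟫ := hwc.inner hgc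
  have hwg0 : ∀ x, x ∉ ball y 3 → ⟪u σ x, gradient (winCutoffAt T y σ) x⟫ = 0 := fun x hx => by
    rw [(winCutoffAt_weights_eq_zero_off_ball (T := T) (y := y) (σ := σ) hx).2.2, inner_zero_right]
  have hwg_i : Integrable (fun x => ⟪u σ x, gradient (winCutoffAt T y σ) x⟫) volume :=
    hwg_c.integrable_of_hasCompactSupport (hasCompactSupport_of_eq_zero_off_ball hwg0)
  have hqg_c : Continuous fun x => p σ x * ⟪u σ x, gradient (winCutoffAt T y σ) x⟫ := hpc.mul hwg_c
  have hqg_i : Integrable (fun x => p σ x * ⟪u σ x, gradient (winCutoffAt T y σ) x⟫) volume :=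
    hqg_c.integrable_of_hasCompactSupport
      (hasCompactSupport_of_eq_zero_off_ball fun x hx => by rw [hwg0 x hx, mul_zero])
  have hng_i : Integrable (fun x => normalisedPressure (u σ) x * ⟪u σ x, gradient (winCutoffAt T y σ) x⟫)
      volume := by
    have e : (fun x => normalisedPressure (u σ) x * ⟪u σ x, gradient (winCutoffAt T y σ) x⟫) =
        fun x => p σ x * ⟪u σ x, gradient (winCutoffAt T y σ) x⟫ -
          c * ⟪u σ x, gradient (winCutoffAt T y σ) x⟫ := by
      funext x; rw [hgauge x]; ring
    rw [e]
    exact hqg_i.sub (hwg_i.const_mul c)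
  refine ⟨?_, horth, ?_⟩
  · have e : (fun x => 2 * p σ x * ⟪u σ x, gradient (winCutoffAt T y σ) x⟫) =
        fun x => 2 * (p σ x * ⟪u σ x, gradient (winCutoffAt T y σ) x⟫) := by
      funext x; ring
    rw [e]; exact hqg_i.const_mul 2
  · have e : (fun x => 2 * p σ x * ⟪u σ x, gradient (winCutoffAt T y σ) x⟫) =
        fun x => 2 * (normalisedPressure (u σ) x * ⟪u σ x, gradient (winCutoffAt T y σ) x⟫) +
          (2 * c) * ⟪u σ x, gradient (winCutoffAt T y σ) x⟫ := by
      funext x; rw [hgauge x]; ring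
    rw [e, integral_add (hng_i.const_mul 2) (hwg_i.const_mul (2 * c)), integral_const_mul,
      integral_const_mul, horth, mul_zero, add_zero]

/-- **The slice bound.** At a time `σ` where the velocity slice `u(σ)` is `C¹`, divergence-free,
in `L²`, bounded by `K_b`, and the pressure slice is the normalised pressure up to a constant
(`p(σ) = p̃[u(σ)] + c`), the `x`-integral of the local-energy right-hand side against the window
cut-off at `(T, y)` is at most `(B₁ + B₂ K_b) · ulocEnergy (u σ)`: the kinetic terms by
`sliceKinetic_le`, the pressure term by `slicePressure_eq` and the linear pressure pairing §M29(c)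
at `r = 3`. [cite: CKN1982, §2 (2.13) p. 779; LemarieRieusset2002, ch. 32–33 (uniformly local
energy estimates)] -/
theorem sliceRHS_le {Mz : ℝ}
    (hM : (∀ s x, |timeDeriv winCutoff s x| ≤ Mz) ∧ (∀ s x, |(Δ (winCutoff s)) x| ≤ Mz) ∧
      (∀ s x, ‖gradient (winCutoff s) x‖ ≤ Mz))
    {C₁ C₂ : ℝ≥0∞}
    (hP : ∀ {w g : EuclideanSpace ℝ (Fin 3) → EuclideanSpace ℝ (Fin 3)} {x₀ : EuclideanSpace ℝ (Fin 3)}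
      {Kb Cg : ℝ} {α : ℝ≥0∞}, 0 ≤ Kb → 0 ≤ Cg → AEStronglyMeasurable w volume →
      Integrable (fun y => ‖w y‖ ^ 2) volume → MemLp (fun y => ‖w y‖ ^ 2) (3 / 2 : ℝ≥0∞) volume →
      (∀ y ∈ ball x₀ (2 * 3), ‖w y‖ ≤ Kb) → (∀ z, ∫⁻ y in ball z 1, ‖w y‖ₑ ^ 2 ≤ α) →
      AEStronglyMeasurable g volume → (∀ x, ‖g x‖ ≤ Cg) → (∀ x ∉ ball x₀ 3, g x = 0) →
      ∫ x, ⟪w x, g x⟫ = 0 →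
      ‖∫ x, normalisedPressure w x * ⟪w x, g x⟫‖ₑ ≤
        ENNReal.ofReal (Kb * Cg) * (C₁ * (∫⁻ y in ball x₀ (2 * 3), ‖w y‖ₑ ^ 2) + C₂ * α))
    {T : ℝ} {y : EuclideanSpace ℝ (Fin 3)}
    {u : ℝ → EuclideanSpace ℝ (Fin 3) → EuclideanSpace ℝ (Fin 3)} {p : ℝ → EuclideanSpace ℝ (Fin 3) → ℝ}
    {σ Kb c : ℝ} (hKb : 0 ≤ Kb) (hu1 : ContDiff ℝ 1 (u σ)) (hdiv : VectorCalculus.IsDivFree (u σ))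
    (hu2 : MemLp (u σ) 2 volume) (hub : ∀ x, ‖u σ x‖ ≤ Kb) (hpc : Continuous (p σ))
    (hgauge : ∀ x, p σ x = normalisedPressure (u σ) x + c) :
    ENNReal.ofReal (∫ x, localEnergyRHS 1 0 u p (winCutoffAt T y) (σ, x)) ≤
      (linkWeight₁ Mz + linkWeight₂ Mz C₁ C₂ * ENNReal.ofReal Kb) * ulocEnergy (u σ) := by
  have hMz : 0 ≤ Mz := (abs_nonneg _).trans (hM.1 0 0)
  have hwc : Continuous (u σ) := hu1.continuous
  have hw_ae : AEStronglyMeasurable (u σ) volume := hwc.aestronglyMeasurable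
  obtain ⟨-, -, hgc⟩ := continuous_winCutoffAt_weights T y σ
  obtain ⟨hF₁i, h1⟩ := sliceKinetic_le hM (T := T) (y := y) hKb hwc hub
  obtain ⟨hF₂i, horth, hF₂eq⟩ := slicePressure_eq (T := T) (y := y) hu1 hdiv hpc hgauge
  have hbd := fun x => winCutoffAt_deriv_bound hM T y σ x
  -- split the slice integral
  have hR : ∀ x, localEnergyRHS 1 0 u p (winCutoffAt T y) (σ, x) =
      (‖u σ x‖ ^ 2 * (timeDeriv (winCutoffAt T y) σ x + (Δ (winCutoffAt T y σ)) x) +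
        ‖u σ x‖ ^ 2 * ⟪u σ x, gradient (winCutoffAt T y σ) x⟫) +
      2 * p σ x * ⟪u σ x, gradient (winCutoffAt T y σ) x⟫ := fun x => by
    rw [localEnergyRHS_apply]
    dsimp only
    rw [Pi.zero_apply, Pi.zero_apply, inner_zero_left]
    ring
  have hsplit : ∫ x, localEnergyRHS 1 0 u p (winCutoffAt T y) (σ, x) =
      (∫ x, ‖u σ x‖ ^ 2 * (timeDeriv (winCutoffAt T y) σ x + (Δ (winCutoffAt T y σ)) x) +
        ‖u σ x‖ ^ 2 * ⟪u σ x, gradient (winCutoffAt T y σ) x⟫) +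
      ∫ x, 2 * p σ x * ⟪u σ x, gradient (winCutoffAt T y σ) x⟫ := by
    rw [integral_congr_ae (Eventually.of_forall hR)]
    exact integral_add hF₁i hF₂i
  -- the pressure pairing
  have hball6 : ∫⁻ x in ball y (2 * 3), ‖u σ x‖ₑ ^ 2 ≤ 343 * ulocEnergy (u σ) := by
    have h := setLIntegral_ball_le_mul_ulocEnergy hw_ae y (by norm_num : (0 : ℝ) < 2 * 3)
    rw [show ENNReal.ofReal ((2 * 3 + 1) ^ 3 : ℝ) = 343 by norm_num] at h
    exact h
  have h2 : ENNReal.ofReal (∫ x, 2 * p σ x * ⟪u σ x, gradient (winCutoffAt T y σ) x⟫) ≤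
      2 * (ENNReal.ofReal (Kb * Mz) * (C₁ * (343 * ulocEnergy (u σ)) + C₂ * ulocEnergy (u σ))) := by
    have hw2i : Integrable (fun x => ‖u σ x‖ ^ 2) volume := (memLp_two_iff_integrable_sq_norm hw_ae).1 hu2
    have hw3 : MemLp (fun x => ‖u σ x‖ ^ 2) (3 / 2 : ℝ≥0∞) volume :=
      memLp_normSq_threeHalves_of_bound hu2 hub
    have hPa := hP hKb hMz hw_ae hw2i hw3 (fun x _ => hub x) (fun z => setLIntegral_ball_le_ulocEnergy (u σ) z)
      hgc.aestronglyMeasurable (fun x => (hbd x).2.2)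
      (fun x hx => (winCutoffAt_weights_eq_zero_off_ball (T := T) (y := y) (σ := σ) hx).2.2) horth
    calc ENNReal.ofReal (∫ x, 2 * p σ x * ⟪u σ x, gradient (winCutoffAt T y σ) x⟫)
        ≤ ENNReal.ofReal ‖∫ x, 2 * p σ x * ⟪u σ x, gradient (winCutoffAt T y σ) x⟫‖ :=
          ENNReal.ofReal_le_ofReal (Real.le_norm_self _)
      _ = 2 * ‖∫ x, normalisedPressure (u σ) x * ⟪u σ x, gradient (winCutoffAt T y σ) x⟫‖ₑ := by
          rw [hF₂eq, norm_mul, Real.norm_ofNat, ENNReal.ofReal_mul (by norm_num), ENNReal.ofReal_ofNat,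
            ofReal_norm]
      _ ≤ 2 * (ENNReal.ofReal (Kb * Mz) *
            (C₁ * (∫⁻ x in ball y (2 * 3), ‖u σ x‖ₑ ^ 2) + C₂ * ulocEnergy (u σ))) :=
          mul_le_mul' le_rfl hPa
      _ ≤ 2 * (ENNReal.ofReal (Kb * Mz) * (C₁ * (343 * ulocEnergy (u σ)) + C₂ * ulocEnergy (u σ))) :=
          mul_le_mul' le_rfl (mul_le_mul' le_rfl (add_le_add (mul_le_mul' le_rfl hball6) le_rfl))
  -- assemble (generalise the two slice integrals first: pure arithmetic remains)
  rw [hsplit]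
  generalize (∫ x, ‖u σ x‖ ^ 2 * (timeDeriv (winCutoffAt T y) σ x + (Δ (winCutoffAt T y σ)) x) +
      ‖u σ x‖ ^ 2 * ⟪u σ x, gradient (winCutoffAt T y σ) x⟫) = I₁ at h1 ⊢
  generalize (∫ x, 2 * p σ x * ⟪u σ x, gradient (winCutoffAt T y σ) x⟫) = I₂ at h2 ⊢
  generalize ulocEnergy (u σ) = U at h1 h2 ⊢
  calc ENNReal.ofReal (I₁ + I₂) ≤ ENNReal.ofReal I₁ + ENNReal.ofReal I₂ := ENNReal.ofReal_add_le
    _ ≤ ENNReal.ofReal ((2 + Kb) * Mz) * (64 * U) +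
          2 * (ENNReal.ofReal (Kb * Mz) * (C₁ * (343 * U) + C₂ * U)) := add_le_add h1 h2
    _ = (linkWeight₁ Mz + linkWeight₂ Mz C₁ C₂ * ENNReal.ofReal Kb) * U := by
        rw [show (2 + Kb) * Mz = 2 * Mz + Kb * Mz by ring,
          ENNReal.ofReal_add (by positivity) (by positivity), ENNReal.ofReal_mul hKb, linkWeight₁,
          linkWeight₂]
        ring

end Summit.NavierStokesRegularity.NavierStokesRegularity.Theorems.StrainDoors

end
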